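import Summits.BirchSwinnertonDyer.BirchSwinnertonDyer.Theorems.SignedBaseChangeAnticyclotomicEisensteinDivisibilityAdmdefSignedLift
import Summits.BirchSwinnertonDyer.BirchSwinnertonDyer.Theorems.AdditiveKolyvaginRoadLocalEquiv
import HarnessLib

/-!
# Line `admdef`, cell β: the (Equiv)-SIGN of a Bertolini–Darmon admissible prime IS its BD congruence sign
# (W. Zhang 2014 (9.2) WITH THE SIGN EXPORTED; crux `AnticyclotomicEisensteinDivisibility`, stmt-BirchSwinnertonDyer-20727;
# LEAD seat bsd-line-sbc-p1 gen 18, `--supports stmt-BirchSwinnertonDyer-20727`)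

WHY THIS FILE.  Skeleton v9 of the line of record `Cruxes/AnticyclotomicEisensteinDivisibility/Lines/admdef.lean` (LEAD gen 17, after the
crux idea «signdetour», bsd-idea-5 g23) runs W. Zhang's Selmer-killing walk with a SIGNED two-prime detour; the detour consumes (Sup±) —
for each sign `s` and each finite set of admissible primes, a NEW admissible prime `q` of (Equiv)-sign `s`, i.e. complex conjugation `c`
acts on `H¹(K_v, E[p])`, `v ∣ q`, by the scalar `sgnP s` (`Signdetour.SignedSupplyAt`).  v9 derives (Sup±) from the residual PRINT stub
(Eig±) `stub_eigenSupply` («both eigenspaces of `c` on `H¹(K, E[p])` are non-zero»).  The prequel `…AdmdefSignedLift.lean`, this file and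
the sequel `…AdmdefSignedSupply.lean` prove (Sup±) on cell β DIRECTLY in the kernel, so that `stub_eigenSupply` can be dropped (v10).  The
sibling cell `AdditiveKolyvaginRoad` proved (Equiv) — `AdditiveKoly.localEquiv_of_admQ : ∀ q, ∃ s, …` — with the sign HIDDEN behind an
existential; here the SAME proof is run with the sign PINNED to the Bertolini–Darmon congruence: if `p ∣ q + 1 − ν·a_q(E)` (`ν = sgnP s = ±1`)
then `c` acts on `H¹(K_v, E[p])` by `ν`.

WHAT IS PROVED (kernel; no definition, no named fact, no `sorry`):
* `localEquiv_of_admQ_of_dvd` — (Equiv) WITH THE SIGN: for `q : AdmQ W K p` and `s : Bool` with `p ∣ q + 1 − sgnP s · a_q(E)`,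
  `loc_v (c_* z) = sgnP s • loc_v z` for every `v ∋ q` and every `z ∈ H¹(K, E[p])` (the proof of `AdditiveKoly.localEquiv_of_admQ` verbatim).

HONEST FRAMING: a port of the AKR cell's theorems (lead `bsd-wall-akr-p1` g2, themselves ports of zhang3-p1's `p = 3` files) with one
hypothesis made explicit; nothing about Heegner points, (Anch±), the BRIDGE or the crux is asserted.  BSD is not proved by this file.

References: [cite: WZhang2014, §9 (9.2), Notations (xiv)] [cite: BertoliniDarmon2005, p. 18, §2.2 Lemma 2.6]
[cite: SerreInventiones1972, §1.8 Prop. 6] [cite: GrossLMS1991, §5 (5.1), §8, §9 Prop. 9.6] [cite: DarmonDiamondTaylor1995, Prop. 2.8 (a)].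
-/

-- D-0017: single-problem summit, the namespace repeats the problem name by design.
set_option linter.dupNamespace false
set_option autoImplicit false

noncomputable section

open scoped Classical Pointwise

namespace Summit.BirchSwinnertonDyer.BirchSwinnertonDyer.Theorems.SignedBaseChangeAcDivAdmdefSignedEquiv

open WeierstrassCurve NumberField IsDedekindDomain Field Rat.HeightOneSpectrum
open Literature.NumberTheory.EllipticCurves Literature.NumberTheory.GaloisRepresentations Module
open Summit.BirchSwinnertonDyer.BirchSwinnertonDyer.Theorems.AdditiveKoly
open Summit.BirchSwinnertonDyer.Rank1Residual.X11b.Three.Koly.Method2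

/-! ## (Equiv) WITH THE SIGN -/

section Equiv

variable (W : WeierstrassCurve ℚ) [W.IsElliptic] [W.IsGloballyMinimal] (K : Type) [Field K] [NumberField K]
  (p : ℕ) [Fact p.Prime]

set_option maxHeartbeats 400000 in
-- (same budget as the AKR original `AdditiveKoly.localEquiv_of_admQ`, whose proof this is)
/-- **(Equiv) WITH THE SIGN EXPORTED** (W. Zhang 2014 (9.2)): for `[K : ℚ] = 2`, `c ≠ 1`, a Bertolini–Darmon admissible `q` and the sign
`s` of its congruence — `p ∣ q + 1 − sgnP s · a_q(E)` — complex conjugation acts on `H¹(K_v, E[p])`, `v ∣ q`, by the scalar `sgnP s`: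
`loc_v (c_* z) = sgnP s • loc_v z` for every `z ∈ H¹(K, E[p])`.  The proof of `AdditiveKoly.localEquiv_of_admQ` verbatim, fed with
`…AdmdefSignedLift.exists_lift_frob_of_dvd` (sign pinned) instead of `exists_lift_frob_of_isAdmissiblePrime` (sign hidden).
[cite: WZhang2014, §9 (9.2)] [cite: SerreInventiones1972, §1.8 Prop. 6] [cite: GrossLMS1991, §5 (5.1), §9 Prop. 9.6] -/
theorem localEquiv_of_admQ_of_dvd (hK2 : Module.finrank ℚ K = 2) {c : K ≃ₐ[ℚ] K} (hc1 : c ≠ 1)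
    (q : AdmQ W K p) (s : Bool) (hdvd : (p : ℤ) ∣ ((q : ℕ) : ℤ) + 1 - sgnP s * W.frobeniusTrace (q : ℕ)) :
    ∀ v : HeightOneSpectrum (𝓞 K), ((q : ℕ) : 𝓞 K) ∈ v.asIdeal → ∀ z : Vp W K p,
      (W.baseChange K).torsionLocMap (v.adicCompletion K) ((p ^ 1 : ℕ) : ℤ) (conjAct W c ((p ^ 1 : ℕ) : ℤ) z) =
        sgnP s • (W.baseChange K).torsionLocMap (v.adicCompletion K) ((p ^ 1 : ℕ) : ℤ) z := by
  -- adapted from Theorems/AdditiveKolyvaginRoadLocalEquiv.lean `localEquiv_of_admQ`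
  have hp : p.Prime := Fact.out
  have hε : sgnP s = 1 ∨ sgnP s = -1 := by cases s <;> simp [sgnP]
  -- the unique place above `q`, a prime of `\bar 𝓞_v` and the lift there
  have hq0 : (q : ℕ) ≠ 0 := q.2.1.ne_zero
  have hqP : (Ideal.span {((q : ℕ) : 𝓞 K)}).IsPrime := q.2.2.2.1
  have hqbot : Ideal.span {((q : ℕ) : 𝓞 K)} ≠ ⊥ := by
    rw [Ne, Ideal.span_singleton_eq_bot]; exact_mod_cast hq0
  set v₀ : HeightOneSpectrum (𝓞 K) := ⟨Ideal.span {((q : ℕ) : 𝓞 K)}, hqP, hqbot⟩ with hv₀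
  have hqv₀ : ((q : ℕ) : 𝓞 K) ∈ v₀.asIdeal := Ideal.subset_span rfl
  obtain ⟨𝔐, h𝔐⟩ := v₀.localPrimesAbove_nonempty
  obtain ⟨hgood, hpv⟩ := hasGoodReductionAt_of_isAdmissiblePrime W K q.2 v₀ hqv₀
  obtain ⟨h, F, ht, hFrob, hFrobF, hF, hcF, hquot, hker⟩ :=
    SignedBaseChangeAcDivAdmdefSignedLift.exists_lift_frob_of_dvd W K hK2 hc1 (n := p ^ 1) (pow_one p).symm q.2 hε hdvd v₀ hqv₀ h𝔐
  have hST := serreTwist_of_admQ K W p hK2 c (n := p ^ 1) (pow_one p) v₀ 𝔐 h𝔐 q q.2 hqv₀ h F hFrob hF ht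
  set ε : ℤ := sgnP s with hεdef
  intro v hqv z
  have hvv : v = v₀ := placesAbove_eq_of_isPrime_span K hqP hq0 hqv₀ hqv
  subst hvv
  set ι₀ := closureEmb (K := K) (v₀.adicCompletion K) with hι₀
  set n : ℤ := ((p ^ 1 : ℕ) : ℤ) with hn
  have hpn : n ≠ 0 := by rw [hn]; exact_mod_cast pow_ne_zero 1 hp.ne_zero
  have hpv' : ((((p ^ 1 : ℕ) : ℤ)) : 𝓞 K) ∉ v₀.asIdeal := by rw [Nat.pow_one]; exact hpv
  have h𝔓 := HeightOneSpectrum.primeBelow_mem_primesAbove (ι := ι₀) h𝔐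
  haveI := h𝔓.1
  have hI : (v₀.primeBelow ι₀ 𝔐).inertia (absoluteGaloisGroup K) ≤ torsionFixing (W.baseChange K) n :=
    inertia_le_torsionFixing (W.baseChange K) (fun h' ↦ h' hgood) hpv' ι₀ h𝔐
  have hFD : F ∈ (v₀.primeBelow ι₀ 𝔐).decompositionSubgroup (absoluteGaloisGroup K) := hFrobF.mem_stabilizer
  obtain ⟨φ, rfl⟩ :=
    oneCocycleClass_surjective (discreteTopRep (absoluteGaloisGroup K) (geomTorsion (W.baseChange K) n)) z
  -- the cocycle of `c_* z`
  set ψ := contOneCocycles.pullback ht.conjGalCMH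
    (resHomOfEquivariant ht.conjGalCMH (ht.torsionMap W n) (ht.torsionMap_smul W n)) φ with hψ
  have hconj : conjAct W c n (oneCocycleClass _ φ) = oneCocycleClass _ ψ := by
    rw [← ht.conjH1_eq_conjAct W n]
    unfold IsLiftOfAut.conjH1
    simp only [LinearMap.toAddMonoidHom_coe, ContinuousLinearMap.coe_coe]
    exact map_oneCocycleClass _ _ _ φ
  have hψapply : ∀ g, ψ.1 g = ht.torsionMap W n (φ.1 (ht.conjGalCMH g)) := fun g ↦ rfl
  -- `χ = ψ − ε φ`; its class is `c_* z − sgn s • z`; it is locally a coboundary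
  have hclass : oneCocycleClass _ (ψ - ε • φ) = oneCocycleClass _ ψ - ε • oneCocycleClass _ φ := by
    rw [oneCocycleClass_sub]
    congr 1
    exact map_zsmul (oneCocycleClassₗ (discreteTopRep (absoluteGaloisGroup K) (geomTorsion (W.baseChange K) n))) ε φ
  suffices hmem : oneCocycleClass _ (ψ - ε • φ) ∈ (W.baseChange K).torsionLocalKer (v₀.adicCompletion K) n by
    have h0 : (W.baseChange K).torsionLocMap (v₀.adicCompletion K) n (oneCocycleClass _ (ψ - ε • φ)) = 0 := hmem
    rw [hclass, map_sub, map_zsmul, sub_eq_zero, ← hconj] at h0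
    rw [h0]
  -- values of `φ` on inertia lie in the `q²`-eigenspace of `F`
  have hφI : ∀ i ∈ (v₀.primeBelow ι₀ 𝔐).inertia (absoluteGaloisGroup K),
      F • φ.1 i = ((((q : ℕ) : ℤ)) ^ 2) • φ.1 i := by
    intro i hi
    have hSTi := (hST φ i hi).2
    have hconjI := conj_mem_inertia K hFD hi
    -- cocycle identity: `φ(F i F⁻¹) = φ(F) + F φ(i) + F i φ(F⁻¹)`, `φ(F⁻¹) = −F⁻¹ φ(F)`
    have h1 := φ.2 (F * i) F⁻¹
    have h2 := φ.2 F i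
    have h3 := φ.2 F F⁻¹
    rw [mul_inv_cancel, contOneCocycles.apply_one, discreteTopRep_ρ_apply] at h3
    rw [discreteTopRep_ρ_apply] at h1 h2
    rw [hSTi, h2] at h1
    -- `(F i) • φ(F⁻¹) = F • φ(F⁻¹)` since `F i F⁻¹` fixes `E[p]`
    have h4 : (F * i) • φ.1 F⁻¹ = F • φ.1 F⁻¹ := by
      have := smul_eq_of_mem_torsionFixing (W.baseChange K) n (hI hconjI) (F • φ.1 F⁻¹)
      rw [← mul_smul, mul_assoc, inv_mul_cancel, mul_one] at this
      exact this
    rw [h4] at h1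
    have h5 : F • φ.1 F⁻¹ = -φ.1 F := eq_neg_of_add_eq_zero_right h3.symm
    rw [h5] at h1
    -- `q² φ i = φ F + F φ i - φ F`
    have h6 : φ.1 F + F • φ.1 i + -φ.1 F = F • φ.1 i := by abel
    rw [h6] at h1
    rw [← h1, ← natCast_zsmul]
    congr 1
    push_cast
    ring
  -- the coboundary correction at `F`
  obtain ⟨P, hP⟩ := hquot (φ.1 F)
  obtain ⟨χ, hχclass, hχapply⟩ := LocalFrob.exists_cocycle_sub_coboundary (W.baseChange K) (ψ - ε • φ) P
  rw [← hχclass, LocalFrob.oneCocycleClass_mem_torsionLocalKer_iff (W.baseChange K) (n := p ^ 1)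
    (pow_ne_zero 1 hp.ne_zero) h𝔐 χ]
  refine ⟨0, fun d hd ↦ ?_⟩
  rw [smul_zero, sub_zero]
  obtain ⟨U, hU, hχU⟩ := LocalFrob.exists_isOpen_subgroup_apply_eq_zero (W.baseChange K) (n := n) hpn χ
  refine LocalFrob.cocycle_apply_eq_zero_of_mem_decompositionSubgroup (W.baseChange K) h𝔓 hFrobF χ ?_ (fun i hi ↦ ?_)
    hU hχU hd
  · -- at `F`: `t φ(t⁻¹ F t) − ε φ(F) − (F P − P) = 0`
    rw [hχapply]
    change ψ.1 F - ε • φ.1 F - (F • P - P) = 0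
    rw [hψapply, hcF, ← hP, sub_self]
  · -- on inertia: `t φ(t⁻¹ i t) − ε φ(i) − (i P − P) = εq · φ(t⁻¹ i t) − ε · q · φ(t⁻¹ i t) = 0`
    rw [hχapply, smul_eq_of_mem_torsionFixing (W.baseChange K) n (hI hi), sub_self, sub_zero]
    change ψ.1 i - ε • φ.1 i = 0
    have hci : ht.conjGalCMH i ∈ (v₀.primeBelow ι₀ 𝔐).inertia (absoluteGaloisGroup K) := by
      have hhD : h ∈ ((v₀.primeBelow ι₀ 𝔐).comap (absIntegersMap ℚ K)).decompositionSubgroup (absoluteGaloisGroup ℚ) :=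
        hFrob.mem_stabilizer
      rw [LocalFrob.mem_inertia_iff_absGaloisRestrict_mem K, LocalFrob.absGaloisRestrict_conjGalCMH K ht]
      have hstab : h⁻¹ • (v₀.primeBelow ι₀ 𝔐).comap (absIntegersMap ℚ K) =
          (v₀.primeBelow ι₀ 𝔐).comap (absIntegersMap ℚ K) :=
        Ideal.mem_decompositionSubgroup_iff.mp (Subgroup.inv_mem _ hhD)
      have := LocalFrob.conj_mem_inertia_smul
        ((LocalFrob.mem_inertia_iff_absGaloisRestrict_mem K (v₀.primeBelow ι₀ 𝔐) i).mp hi) h⁻¹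
      rwa [inv_inv, hstab] at this
    rw [hψapply, (hST φ i hi).1, hker _ (hφI _ hci), ← natCast_zsmul, smul_smul, sub_self]

end Equiv

end Summit.BirchSwinnertonDyer.BirchSwinnertonDyer.Theorems.SignedBaseChangeAcDivAdmdefSignedEquiv

end
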